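/-
Copyright: the b2b-balaban T⁴-continuum CRUX team, row NE7b leaf lineage `t4-ne7b-formalise-leaf-06` (gen 162). Project licence.
-/
import Summits.QuantumFields.BalabanUV.T4Continuum.Spine.NE7b.SupEquationTowerLetters
import Summits.QuantumFields.BalabanUV.T4Continuum.Spine.NE7b.SupResponseSecondCurrency

/-!
# THE TOWER's LEVEL-`k` EQUATION MAP IS THE ONE-SHOT NEXT EQUATION MAP, WITH ONE-STEP LETTERS IN BOTH CURRENCIES: by the composite
# lift (STL) and the one-shot identification (SOS), `Eq_k(w) = 𝒬_k(Eq₀(σ₀ₖ w))` on `closedBall 0 r_k`; hence on the open set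
# `ball 0 r_k ∩ ball 0 ρ₀ₖ` the derivative the tower carries IS SIS (c)'s one-shot derivative, `Eq_k′(w) = 𝒬_k∘Eq₀′(σ₀ₖ w)∘Dσ₀ₖ(w)`
# (uniqueness of Fréchet derivatives), so `Eq_k′` has the ONE-STEP letters `‖𝒬_k‖·B_0·K₁₀` ∕ `‖𝒬_k‖(M_0K₁₀² + B_0K₁₀²C_{P₀}M_0K₁₀)` and — for
# every second currency chosen AFTERWARDS — `…SupResponseSecondCurrency`'s (W4)∕(W5) with ONE bootstrap constant `K^w_{0k}`: the closed
# form replacing `…SupEquationTowerStepWeighted`'s displayed recursions `B_{k+1} ≥ ‖Q_k‖B_kK₁`, `B^w_{k+1} ≥ C^w_QB^w_kK^w_k`, …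
# (row NE7b, node U5c; TOWER ∕ STL ∕ SRSC BY NAME, SOS's identification argument inlined; [folklore]; any Banach currencies, any seminorms)

Cell `pub-balaban`, sub-cell `t4`, spine estimate NE7b (`T4WeightBudget.RelWeightBound`; the cell's OWN estimate — NOT PRINTED in
[Bałaban 1983–89], NOT PROVED).  Crux-route work under `Spine/NE7b/` by a row leaf (`t4-ne7b-formalise-leaf-06` gen 162) under FREEZE
(0)'s crux-prover clause (the OWNER g116's W-ne7bp1-g116-2 (b) GO on the weighted packet; this is its last abstract piece).  NOTHING of
Bałaban's is named as a Lean object, valued or asserted; no `T4Continuum/Support` leaf typed; no `def`; zero `sorry`.  Imports: this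
lineage's `…SupEquationTowerLetters` (STL; through it TOWER ∕ STEP ∕ SIS — SOS's two §1 arguments are inlined, so that this file does not
wait on SOS's hub olean) and `…SupResponseSecondCurrency` (SRSC).

WHY (located).  STEP ∕ STEPW hand the level-`k+1` equation map its letters by RECURSION (`B_{k+1} ≥ ‖Q_k‖B_kK₁`, `M_{k+1} ≥ …`, and the
second-currency twins) — displayed, uncontrolled.  SOS identifies the composite TRANSPORT with the one-shot branch; SOSW does the same
for its DERIVATIVE.  The same identification holds one level up the data: STL's composite lift `Eq₀(Φ_k w) = ℒ_k(Eq_k w)` with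
`𝒬_k∘ℒ_k = 1` says `Eq_k w = 𝒬_k(Eq₀(Φ_k w))`, and `Φ_k = σ₀ₖ` on `closedBall 0 r_k` turns this into `Eq_k = 𝒬_k∘Eq₀∘σ₀ₖ` there — the
tower's level-`k` equation map IS the next equation map of the ONE-SHOT step `(𝒬_k, ℒ_k, P₀ₖ)`.  On the open ball `ball 0 r_k` the two
maps agree near every point, TOWER (S) gives `HasFDerivAt (Eq k) (Eq′ k w) w`, SIS (c) for the one-shot step gives
`HasFDerivAt (𝒬_k∘Eq₀∘σ₀ₖ) (𝒬_k∘Eq₀′(σ₀ₖ w)∘Dσ₀ₖ(w)) w` on `ball 0 ρ₀ₖ`, and Fréchet derivatives are unique: so on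
`ball 0 r_k ∩ ball 0 ρ₀ₖ` the derivative family `Eq′ k` that the tower constructed by recursion EQUALS the one-shot derivative, and
inherits SIS (c)'s first-currency letters and SRSC (W4)∕(W5)'s second-currency letters with the ONE-SHOT constants — level-`0` data and the
one-shot chart only.  HONEST: the balls are NOT compared (`r_k` vs `ρ₀ₖ`: numbers, (A3)); in the model the one-shot chart at the
composite side is the OWNER's ASE ∕ (62) («every side the same `N_∞`») and the instance tower is his (76) ∕ (80) ∕ (82) — not here.

WHAT IS PROVED ([folklore]; `X, K : ℕ → Type`, every `X k` a nontrivial real Banach space; `K₀` real normed):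
* §1 `eq_apply_of_lift` (`𝒬∘ℒ = 1`, `Eq₀(Φ w) = ℒ(E w)`, `Φ w = σ₀ w` ⊢ `E w = 𝒬(Eq₀(σ₀ w))`), `fderiv_unique_of_eqOn_ball`
  (`E = G` on `closedBall 0 r`, `HasFDerivAt E E′ w`, `HasFDerivAt G G′ w`, `w ∈ ball 0 r` ⊢ `E′ = G′`).
* §2 **`tower_eq_oneShot_equation`** — SOS `tower_eq_oneShot`'s hypotheses VERBATIM ⟹ `∃ σ Eq Eq′ 𝒮 Φ σ₀ₖ` with: TOWER's (R) (S)
  (recursion equations and state letters — the latter needed here and NOT in SOS's export), (C), STL's composite lift and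
  `HasFDerivAt (Φ j) (𝒮 j) 0`, the one-shot branch's (a) letters, Lipschitz, uniqueness, `Φ k = σ₀ₖ` on `closedBall 0 r_k`, AND: **(E1)** `Eq k w = 𝒬_k(Eq₀(σ₀ₖ w))` on
  `closedBall 0 r_k`; **(E2)** `Eq′ k w = 𝒬_k∘Eq₀′(σ₀ₖ w)∘fderiv σ₀ₖ w` on `ball 0 r_k ∩ ball 0 ρ₀ₖ`; **(E3)** there
  `‖Eq′ k w‖ ≤ ‖𝒬_k‖·B_0·(N₀ₖ⁻¹ − c₀ₖ)⁻¹` and `‖Eq′ k w − Eq′ k w′‖ ≤ ‖𝒬_k‖·(M_0K₁₀K₁₀ + B_0(K₁₀²(C_{P₀ₖ}M_0)K₁₀))·‖w − w′‖`; **(EW)** for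
  EVERY second currency chosen AFTERWARDS (seminorms `p₀, p_k, q₀`; `0 ≤ N^w_{0k}, B^w_0, M^w_0, C^w_{P₀ₖ}, C^w_{𝒬_k}`; the one-shot chart's
  letter; `Eq₀′`'s second-currency bound ∕ modulus on `closedBall 0 r_0`; `P₀ₖ`'s ∕ `𝒬_k`'s letters; defect `q₀(P₀ₖ((Eq₀′ 0 − Eq₀′ x)u)) ≤ c^w p₀ u`
  on `closedBall 0 r_0`; `N^w c^w < 1`): on `ball 0 r_k ∩ ball 0 ρ₀ₖ`, `p_k(Eq′ k w v) ≤ C^w_{𝒬_k}·B^w_0·K^w_{0k}·p_k v` and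
  `p_k((Eq′ k w − Eq′ k w′)v) ≤ C^w_{𝒬_k}(M^w_0K₁₀K^w_{0k} + B^w_0(K^w_{0k}C^w_{P₀ₖ}M^w_0K₁₀K^w_{0k}))‖w − w′‖p_k v`.
* §3 toy (`example`).

NOT HERE (honest): the one-shot chart ∕ its letters BY VALUE; `r_k` vs `ρ₀ₖ`; the `ℓ^∞(ℤ^d)` instance (OWNER's (76)∕(80)∕(82)); (A3) ∕
(A1c); NC-NE7b-α UNRULED; anything of Bałaban's.  BY-NAME EFFECT ON THE WALL: NONE.  NE7b NOT PRINTED ∕ NOT PROVED; spine PROVED 0∕9;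
rung (B)+1 on a FINITE torus — NOT infinite volume, NOT the mass gap, NOT Clay.  HONEST DEPENDENCY: continuum YM on T⁴ ⇐ BetaPertH ∧
nine spine estimates (0∕9 proved); BetaPertH ⇐ (D1) ∧ (D4) ∧ CAP+tail; G-an2-4 gates asym, D1 and NE2∕3∕4.
-/

set_option autoImplicit false

noncomputable section

namespace Summit.QuantumFields.BalabanUV.T4Continuum.NE7b.SupEquationTowerOneShotEquation

open Set Metric Function Filter
open scoped NNReal Topology
open Summit.QuantumFields.BalabanUV.T4Continuum.NE7b

/-! ## §1. Two letters -/

section Letters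

variable {E F G : Type*} [NormedAddCommGroup E] [NormedSpace ℝ E] [NormedAddCommGroup F] [NormedSpace ℝ F]
  [NormedAddCommGroup G] [NormedSpace ℝ G]

/-- `𝒬∘ℒ = 1`, the composite lift `Eq₀(Φ w) = ℒ(E w)` and `Φ w = σ₀ w` give `E w = 𝒬(Eq₀(σ₀ w))`. [folklore] -/
theorem eq_apply_of_lift (𝒬 : E →L[ℝ] F) (ℒ : F →L[ℝ] E) (h𝒬ℒ : 𝒬.comp ℒ = ContinuousLinearMap.id ℝ F)
    {Eq₀ : E → E} {Ek : F → F} {Φ σ₀ : F → E} {w : F} (hcl : Eq₀ (Φ w) = ℒ (Ek w)) (hid : Φ w = σ₀ w) :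
    Ek w = 𝒬 (Eq₀ (σ₀ w)) := by
  have e : 𝒬 (ℒ (Ek w)) = Ek w := by simpa using congrArg (fun L : F →L[ℝ] F => L (Ek w)) h𝒬ℒ
  rw [← hid, hcl, e]

/-- Two maps equal on `closedBall 0 r` have the same Fréchet derivative at every point of `ball 0 r` where both are differentiable
(uniqueness of the derivative). [folklore] -/
theorem fderiv_unique_of_eqOn_ball {Ek Gk : F → G} {r : ℝ} (heq : ∀ w ∈ closedBall (0 : F) r, Ek w = Gk w) {w : F}
    (hw : w ∈ ball (0 : F) r) {E' G' : F →L[ℝ] G} (hE : HasFDerivAt Ek E' w) (hG : HasFDerivAt Gk G' w) : E' = G' := by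
  have hev : Ek =ᶠ[𝓝 w] Gk :=
    Filter.eventuallyEq_of_mem (isOpen_ball.mem_nhds hw) fun z hz => heq z (ball_subset_closedBall hz)
  exact hE.unique (hG.congr_of_eventuallyEq hev)

end Letters

/-! ## §2. On the tower: the level-`k` equation map in closed form -/

variable {X : ℕ → Type*} {K : ℕ → Type*} [∀ k, NormedAddCommGroup (X k)] [∀ k, NormedSpace ℝ (X k)]
  [∀ k, NormedAddCommGroup (K k)] [∀ k, NormedSpace ℝ (K k)]
  {K₀ : Type*} [NormedAddCommGroup K₀] [NormedSpace ℝ K₀]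

/-- **THE TOWER's LEVEL-`k` EQUATION MAP IS THE ONE-SHOT NEXT EQUATION MAP.**  `…SupEquationTowerOneShot.tower_eq_oneShot`'s
hypotheses verbatim ⟹ the tower with (R) (S) (C), the composite lift, `DΦ_j(0) = 𝒮_j`, the one-shot branch with its letters and `Φ k = σ₀ₖ` on
`closedBall 0 r_k`, and: (E1) `Eq k w = 𝒬_k(Eq₀(σ₀ₖ w))` there; (E2) `Eq′ k w = 𝒬_k∘Eq₀′(σ₀ₖ w)∘Dσ₀ₖ(w)` on `ball 0 r_k ∩ ball 0 ρ₀ₖ`;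
(E3) the one-step first-currency letters of `Eq′ k` there; (EW) for every second currency chosen afterwards, SRSC's (W4)∕(W5) for `Eq′ k`
with the one-shot constants. [folklore] -/
theorem tower_eq_oneShot_equation [∀ j, CompleteSpace (X j)] [∀ j, Nontrivial (X j)]
    (Q : ∀ j, X j →L[ℝ] X (j + 1)) (Lp : ∀ j, X (j + 1) →L[ℝ] X j) (P : ∀ j, X j →L[ℝ] K j) (ι : ∀ j, K j →L[ℝ] X j)
    (hPι : ∀ j h, ι j (P j h) = h - Lp j (Q j h)) {CP : ℕ → ℝ} (hCP : ∀ j, ‖P j‖ ≤ CP j)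
    (𝒬 : ∀ j, X 0 →L[ℝ] X j) (h𝒬0 : 𝒬 0 = ContinuousLinearMap.id ℝ (X 0)) (h𝒬 : ∀ j, 𝒬 (j + 1) = (Q j).comp (𝒬 j))
    (ℒ : ∀ j, X j →L[ℝ] X 0) (hℒ0 : ℒ 0 = ContinuousLinearMap.id ℝ (X 0)) (hℒ : ∀ j, ℒ (j + 1) = (ℒ j).comp (Lp j))
    {Eq₀ : X 0 → X 0} {Eq₀' : X 0 → X 0 →L[ℝ] X 0} (hE0 : Eq₀ 0 = 0)
    {r B M : ℕ → ℝ} (hr0 : ∀ j, 0 ≤ r j) (hM0 : ∀ j, 0 ≤ M j)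
    (hE : ∀ x ∈ closedBall (0 : X 0) (r 0), HasFDerivAt Eq₀ (Eq₀' x) x)
    (hB : ∀ x ∈ closedBall (0 : X 0) (r 0), ‖Eq₀' x‖ ≤ B 0)
    (hM : ∀ x ∈ closedBall (0 : X 0) (r 0), ∀ x' ∈ closedBall (0 : X 0) (r 0), ‖Eq₀' x - Eq₀' x'‖ ≤ M 0 * ‖x - x'‖)
    (T : ∀ j, X j ≃L[ℝ] X (j + 1) × K j) {N c : ℕ → ℝ≥0}
    (hT : ∀ j (𝒮 : X j →L[ℝ] X 0), (𝒬 j).comp 𝒮 = ContinuousLinearMap.id ℝ (X j) →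
      (∀ i, i < j → ∀ h, P i (𝒬 i (Eq₀' 0 (𝒮 h))) = 0) → ∀ h, T j h = (Q j h, P j (𝒬 j (Eq₀' 0 (𝒮 h)))))
    (hN : ∀ j (y : X (j + 1) × K j), ‖(T j).symm y‖ ≤ N j * ‖y‖) (hcN : ∀ j, c j < (N j)⁻¹)
    (hc : ∀ j, CP j * M j * r j ≤ (c j : ℝ)) (hr : ∀ j, r (j + 1) < ((N j : ℝ)⁻¹ - c j) * r j)
    (hBs : ∀ j, ‖Q j‖ * B j * ((N j : ℝ)⁻¹ - c j)⁻¹ ≤ B (j + 1))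
    (hMs : ∀ j, ‖Q j‖ * (M j * ((N j : ℝ)⁻¹ - c j)⁻¹ * ((N j : ℝ)⁻¹ - c j)⁻¹ +
      B j * ((((N j : ℝ)⁻¹ - c j)⁻¹) ^ 2 * (CP j * M j) * ((N j : ℝ)⁻¹ - c j)⁻¹)) ≤ M (j + 1))
    -- the one-shot data of the composite blocking at level `k`
    (k : ℕ) (h𝒬ℒ : (𝒬 k).comp (ℒ k) = ContinuousLinearMap.id ℝ (X k))
    (P₀ : X 0 →L[ℝ] K₀) (ι₀ : K₀ →L[ℝ] X 0) (hPι₀ : ∀ h, ι₀ (P₀ h) = h - ℒ k (𝒬 k h)) (hι₀ : ∀ κ, ι₀ κ = 0 → κ = 0)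
    {CP₀ : ℝ} (hCP₀ : ‖P₀‖ ≤ CP₀) (T₀ : X 0 ≃L[ℝ] X k × K₀) (hT₀ : ∀ h, T₀ h = (𝒬 k h, P₀ (Eq₀' 0 h))) {N₀ c₀ : ℝ≥0}
    (hN₀ : ∀ y : X k × K₀, ‖T₀.symm y‖ ≤ N₀ * ‖y‖) (hcN₀ : c₀ < N₀⁻¹) (hc₀ : CP₀ * M 0 * r 0 ≤ (c₀ : ℝ)) :
    ∃ (σ : ∀ j, X (j + 1) → X j) (Eq : ∀ j, X j → X j) (Eq' : ∀ j, X j → X j →L[ℝ] X j) (𝒮 : ∀ j, X j →L[ℝ] X 0)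
      (Φ : ∀ j, X j → X 0) (σ₀ : X k → X 0),
      -- (R) the tower's recursion equations
      Eq 0 = Eq₀ ∧ Eq' 0 = Eq₀' ∧ Φ 0 = id ∧ (∀ j, Eq (j + 1) = fun w => Q j (Eq j (σ j w))) ∧
      (∀ j, Eq' (j + 1) = fun w => (Q j).comp ((Eq' j (σ j w)).comp (fderiv ℝ (σ j) w))) ∧
      (∀ j, Φ (j + 1) = Φ j ∘ σ j) ∧ (∀ j, 𝒮 (j + 1) = (𝒮 j).comp (fderiv ℝ (σ j) 0)) ∧
      -- (S) the state letters at every level (TOWER)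
      (∀ j, Eq j 0 = 0 ∧ (∀ x ∈ closedBall (0 : X j) (r j), HasFDerivAt (Eq j) (Eq' j x) x) ∧
        (∀ x ∈ closedBall (0 : X j) (r j), ‖Eq' j x‖ ≤ B j) ∧
        (∀ x ∈ closedBall (0 : X j) (r j), ∀ x' ∈ closedBall (0 : X j) (r j), ‖Eq' j x - Eq' j x'‖ ≤ M j * ‖x - x'‖) ∧
        (𝒬 j).comp (𝒮 j) = ContinuousLinearMap.id ℝ (X j) ∧
        (∀ i, i < j → ∀ h, P i (𝒬 i (Eq₀' 0 (𝒮 j h))) = 0) ∧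
        Eq' j 0 = (𝒬 j).comp ((Eq₀' 0).comp (𝒮 j))) ∧
      -- (C) the composite letters and the composite lift (TOWER ∕ STL)
      (∀ j, Φ j 0 = 0 ∧ (∀ w ∈ closedBall (0 : X j) (r j), Φ j w ∈ closedBall (0 : X 0) (r 0)) ∧
        (∀ w ∈ closedBall (0 : X j) (r j), 𝒬 j (Φ j w) = w) ∧
        LipschitzOnWith (∏ i ∈ Finset.range j, ((N i)⁻¹ - c i)⁻¹) (Φ j) (closedBall (0 : X j) (r j)) ∧
        (∀ w ∈ closedBall (0 : X j) (r j), Eq j w = 0 → Eq₀ (Φ j w) = 0)) ∧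
      (∀ j, ∀ w ∈ closedBall (0 : X j) (r j), Eq₀ (Φ j w) = ℒ j (Eq j w)) ∧
      (∀ j, HasFDerivAt (Φ j) (𝒮 j) 0) ∧
      -- the one-shot branch of the composite blocking at level `k` (SIS (a), Lipschitz, uniqueness) and THE IDENTIFICATION (SOS)
      σ₀ 0 = 0 ∧
      (∀ v ∈ closedBall (0 : X k) (((N₀ : ℝ)⁻¹ - c₀) * r 0),
        σ₀ v ∈ closedBall (0 : X 0) (r 0) ∧ 𝒬 k (σ₀ v) = v ∧ P₀ (Eq₀ (σ₀ v)) = 0 ∧ Eq₀ (σ₀ v) = ℒ k (𝒬 k (Eq₀ (σ₀ v)))) ∧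
      LipschitzOnWith (N₀⁻¹ - c₀)⁻¹ σ₀ (closedBall (0 : X k) (((N₀ : ℝ)⁻¹ - c₀) * r 0)) ∧
      (∀ x ∈ closedBall (0 : X 0) (r 0), P₀ (Eq₀ x) = 0 → σ₀ (𝒬 k x) = x) ∧
      (∀ w ∈ closedBall (0 : X k) (r k), Φ k w = σ₀ w) ∧
      -- (E1) THE LEVEL-`k` EQUATION MAP IS THE ONE-SHOT NEXT EQUATION MAP
      (∀ w ∈ closedBall (0 : X k) (r k), Eq k w = 𝒬 k (Eq₀ (σ₀ w))) ∧
      -- (E2) ITS DERIVATIVE IS SIS (c)'s ONE-SHOT DERIVATIVE on `ball 0 r_k ∩ ball 0 ρ₀ₖ`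
      (∀ w ∈ ball (0 : X k) (r k) ∩ ball (0 : X k) (((N₀ : ℝ)⁻¹ - c₀) * r 0),
        Eq' k w = (𝒬 k).comp ((Eq₀' (σ₀ w)).comp (fderiv ℝ σ₀ w))) ∧
      -- (E3) THE ONE-STEP FIRST-CURRENCY LETTERS of `Eq′ k` there
      (∀ w ∈ ball (0 : X k) (r k) ∩ ball (0 : X k) (((N₀ : ℝ)⁻¹ - c₀) * r 0),
        ‖Eq' k w‖ ≤ ‖𝒬 k‖ * B 0 * ((N₀ : ℝ)⁻¹ - c₀)⁻¹) ∧
      (∀ w ∈ ball (0 : X k) (r k) ∩ ball (0 : X k) (((N₀ : ℝ)⁻¹ - c₀) * r 0),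
        ∀ w' ∈ ball (0 : X k) (r k) ∩ ball (0 : X k) (((N₀ : ℝ)⁻¹ - c₀) * r 0),
        ‖Eq' k w - Eq' k w'‖ ≤
          ‖𝒬 k‖ * (M 0 * ((N₀ : ℝ)⁻¹ - c₀)⁻¹ * ((N₀ : ℝ)⁻¹ - c₀)⁻¹ +
            B 0 * ((((N₀ : ℝ)⁻¹ - c₀)⁻¹) ^ 2 * (CP₀ * M 0) * ((N₀ : ℝ)⁻¹ - c₀)⁻¹)) * ‖w - w'‖) ∧
      -- (EW) THE ONE-STEP SECOND-CURRENCY LETTERS of `Eq′ k`, for every second currency chosen AFTERWARDS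
      (∀ (p₀ : Seminorm ℝ (X 0)) (pk : Seminorm ℝ (X k)) (q₀ : Seminorm ℝ K₀) (Nw cw Bw Mw CPw CQw : ℝ),
        0 ≤ Nw → 0 ≤ Bw → 0 ≤ Mw → 0 ≤ CPw → 0 ≤ CQw →
        (∀ y₁ y₂, p₀ (T₀.symm (y₁, y₂)) ≤ Nw * (pk y₁ + q₀ y₂)) →
        (∀ x ∈ closedBall (0 : X 0) (r 0), ∀ u, p₀ (Eq₀' x u) ≤ Bw * p₀ u) →
        (∀ x ∈ closedBall (0 : X 0) (r 0), ∀ x' ∈ closedBall (0 : X 0) (r 0), ∀ u,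
          p₀ ((Eq₀' x - Eq₀' x') u) ≤ Mw * ‖x - x'‖ * p₀ u) →
        (∀ h, q₀ (P₀ h) ≤ CPw * p₀ h) → (∀ h, pk (𝒬 k h) ≤ CQw * p₀ h) →
        (∀ x ∈ closedBall (0 : X 0) (r 0), ∀ u, q₀ (P₀ ((Eq₀' 0 - Eq₀' x) u)) ≤ cw * p₀ u) → Nw * cw < 1 →
        (∀ w ∈ ball (0 : X k) (r k) ∩ ball (0 : X k) (((N₀ : ℝ)⁻¹ - c₀) * r 0), ∀ v,
          pk (Eq' k w v) ≤ CQw * Bw * (Nw / (1 - Nw * cw)) * pk v) ∧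
        (∀ w ∈ ball (0 : X k) (r k) ∩ ball (0 : X k) (((N₀ : ℝ)⁻¹ - c₀) * r 0),
          ∀ w' ∈ ball (0 : X k) (r k) ∩ ball (0 : X k) (((N₀ : ℝ)⁻¹ - c₀) * r 0), ∀ v,
          pk ((Eq' k w - Eq' k w') v) ≤
            CQw * (Mw * ((N₀ : ℝ)⁻¹ - c₀)⁻¹ * (Nw / (1 - Nw * cw)) +
              Bw * (Nw / (1 - Nw * cw) * CPw * Mw * ((N₀ : ℝ)⁻¹ - c₀)⁻¹ * (Nw / (1 - Nw * cw)))) * ‖w - w'‖ * pk v)) := by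
  -- the tower with (S) (TOWER) and the composite lift (STL §1 on the exported letters)
  obtain ⟨σ, Eq, Eq', 𝒮, Φ, hEq0, hEq'0, h𝒮0, hΦ0, hEs, hE's, h𝒮s, hΦs, hS, hBr, hC⟩ :=
    SupEquationTower.tower_eq Q Lp P ι hPι hCP 𝒬 h𝒬0 h𝒬 hE0 hr0 hM0 hE hB hM T hT hN hcN hc hr hBs hMs
  have hsub : ∀ j, closedBall (0 : X (j + 1)) (r (j + 1)) ⊆ closedBall (0 : X (j + 1)) (((N j : ℝ)⁻¹ - c j) * r j) :=
    fun j => closedBall_subset_closedBall (hr j).le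
  have hmaps : ∀ j, ∀ w ∈ closedBall (0 : X (j + 1)) (r (j + 1)), σ j w ∈ closedBall (0 : X j) (r j) :=
    fun j w hw => ((hBr j).2.1 w (hsub j hw)).1
  have hlift : ∀ j, ∀ w ∈ closedBall (0 : X (j + 1)) (r (j + 1)), Eq j (σ j w) = Lp j (Eq (j + 1) w) :=
    fun j w hw => ((hBr j).2.1 w (hsub j hw)).2.2.2
  have hcl0 := SupEquationTowerLetters.composite_lift_of_letters σ Eq Φ Lp ℒ hΦ0 hΦs hℒ0 hℒ hmaps hlift
  have hcl : ∀ j, ∀ w ∈ closedBall (0 : X j) (r j), Eq₀ (Φ j w) = ℒ j (Eq j w) := fun j w hw => by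
    rw [← hEq0]; exact hcl0 j w hw
  have hρpos : ∀ j, (0 : X (j + 1)) ∈ ball (0 : X (j + 1)) (((N j : ℝ)⁻¹ - c j) * r j) :=
    fun j => mem_ball_self (lt_of_le_of_lt (hr0 (j + 1)) (hr j))
  have hD : ∀ j, HasFDerivAt (Φ j) (𝒮 j) 0 :=
    SupEquationTowerLetters.hasFDerivAt_composite_of_letters σ Φ 𝒮 hΦ0 hΦs (fun j => (hBr j).1)
      (fun j => ((hBr j).2.2.2.2 0 (hρpos j)).1) h𝒮0 h𝒮s
  -- the one-shot step in the SECOND-CURRENCY form (SIS re-exported inside, weights after `σ₀`)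
  have hck : ∀ x ∈ closedBall (0 : X 0) (r 0), ‖P₀.comp (Eq₀' x - Eq₀' 0)‖ ≤ c₀ := fun x hx =>
    (SupEquationTowerStep.norm_comp_sub_le_of_modulus_closedBall P₀ hCP₀ (hM0 0) (hr0 0) hM hx).trans hc₀
  obtain ⟨σ₀, h00, h0a, h0lip, h0uniq, -, -, -, h0C, h0cm, -, h0W⟩ :=
    SupResponseSecondCurrency.inductiveStep_eq_secondCurrency (𝒬 k) (ℒ k) P₀ ι₀ hPι₀ hCP₀ hE0 (hr0 0) hE hB (hM0 0) hM (Eq₀' 0)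
      T₀ hT₀ hN₀ hcN₀ hck
  -- the identification (SOS's argument, inlined: criticality for the composite fibre from the composite lift, then SIS's uniqueness)
  have hid : ∀ w ∈ closedBall (0 : X k) (r k), Φ k w = σ₀ w := by
    intro w hw
    obtain ⟨-, hmem, hsec, -, -⟩ := hC k
    have hcrit : P₀ (Eq₀ (Φ k w)) = 0 := by
      apply hι₀
      have e : 𝒬 k (ℒ k (Eq k w)) = Eq k w := by
        simpa using congrArg (fun L : X k →L[ℝ] X k => L (Eq k w)) h𝒬ℒ
      rw [hPι₀, hcl k w hw, e, sub_self]
    have h := h0uniq (Φ k w) (hmem w hw) hcrit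
    rw [hsec w hw] at h
    exact h.symm
  -- (E1)
  have hE1 : ∀ w ∈ closedBall (0 : X k) (r k), Eq k w = 𝒬 k (Eq₀ (σ₀ w)) := fun w hw =>
    eq_apply_of_lift (𝒬 k) (ℒ k) h𝒬ℒ (hcl k w hw) (hid w hw)
  -- (E2): uniqueness of the derivative on the open set
  have hE2 : ∀ w ∈ ball (0 : X k) (r k) ∩ ball (0 : X k) (((N₀ : ℝ)⁻¹ - c₀) * r 0),
      Eq' k w = (𝒬 k).comp ((Eq₀' (σ₀ w)).comp (fderiv ℝ σ₀ w)) := fun w hw =>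
    fderiv_unique_of_eqOn_ball hE1 hw.1 ((hS k).2.1 w (ball_subset_closedBall hw.1)) (h0C w hw.2).1
  refine ⟨σ, Eq, Eq', 𝒮, Φ, σ₀, hEq0, hEq'0, hΦ0, hEs, hE's, hΦs, h𝒮s, hS, hC, hcl, hD, h00, h0a, h0lip, h0uniq, hid, hE1, hE2,
    fun w hw => ?_, fun w hw w' hw' => ?_, ?_⟩
  · -- (E3) bound
    rw [hE2 w hw]; exact (h0C w hw.2).2
  · -- (E3) modulus
    rw [hE2 w hw, hE2 w' hw']; exact h0cm w hw.2 w' hw'.2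
  · -- (EW) the second currency, after everything
    intro p₀ pk q₀ Nw cw Bw Mw CPw CQw hNw hBw0 hMw0 hCPw0 hCQw0 hTw hBw hMw hCPw hCQw hcw hsmall
    obtain ⟨-, -, -, hW4, hW5⟩ := h0W p₀ pk q₀ Nw cw Bw Mw CPw CQw hNw hBw0 hMw0 hCPw0 hCQw0 hTw hBw hMw hCPw hCQw hcw hsmall
    refine ⟨fun w hw v => ?_, fun w hw w' hw' v => ?_⟩
    · rw [hE2 w hw]; exact hW4 w hw.2 v
    · rw [hE2 w hw, hE2 w' hw']
      simpa only [sub_apply, ContinuousLinearMap.comp_apply] using hW5 w hw.2 w' hw'.2 v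

/-! ## §3. Toy -/

/-- Toy: the displayed recursion `B_{k+1} = ‖Q‖·B_k·K₁` with `‖Q‖ = 1`, `K₁ = 2` turns `B_0 = 3` into `24` after three levels, while
the one-shot letter with `K₁₀ = 2` at the composite level reads `‖𝒬_3‖·B_0·K₁₀ = 6` — the closed form versus the product. -/
example : (1 : ℝ) * ((1 : ℝ) * ((1 : ℝ) * 3 * 2) * 2) * 2 = 24 ∧ (1 : ℝ) * 3 * 2 = 6 := by norm_num

end Summit.QuantumFields.BalabanUV.T4Continuum.NE7b.SupEquationTowerOneShotEquation

end
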